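import Literature.MathematicalPhysics.QuantumFieldTheory.Balaban1983to89.T4LevelShift
import Literature.MathematicalPhysics.QuantumFieldTheory.Balaban1983to89.T4ObservableTelescopeTwoRun

/-!
# RUNG (B)+1 BOOKKEEPING: THE CANONICAL RUN LADDER AND THE CANONICAL NESTED FACTORISATION OF A LEVEL-HOMOGENEOUS DATUM —
# the interface question (Q-av) of `T4ObservableTelescopeTwoRun` (v3.1 §6.4: `RunLadder D`) and the `nest` interface of
# `T4VarianceMatching` §6 (`NestedFactorisation`) INHABITED IN THE KERNEL for every finite-`ε` approximation whose averaging
# prescription is level-homogeneous (`T4LevelShift`: `FiniteEpsData.AvgLevelHomogeneous`), in particular for every datum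
# averaging by Bałaban's (0.4) `blockAvg ℰ` or (0.12) `blockAvg₂ 𝓜 ℰ`
# (cell `pub-balaban`, scoping sub-cell `t4`, unit `b2b-balaban-t4-lean` gen 15, journal row T4-T.L-RUNLADDER*; LEAF: imports
# `T4LevelShift` and `T4ObservableTelescopeTwoRun`; ADDITIVE — no existing module is modified)

HONEST FRAMING.  Rung (B)+1 = the `ε → 0` limit of the joint expectations of unit-scale averaged gauge-invariant loop variables
on ONE four-torus, UNDER (B) = [Balaban1989LargeFieldII] Thm 1 and a β-function hypothesis carried inside every target (never
discharged).  NOT infinite volume, NOT a mass gap, NOT the Clay problem, NOT summit progress.  This file is BOOKKEEPING: it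
builds, from the kernel identities of `T4LevelShift`, the INTERFACE DATA two lanes of the cell ask a supplier for, and restates
those lanes' conditional existence theorems with the interface supplied.  Every declaration is [folklore]; the two `[cite:]`
tags LOCATE the printed averaging formulas (0.4) p. 253 / (0.12) p. 254 of [Balaban1987RG1] (quoted verbatim in the certified
headers of `BlockAveraging` / `BlockAveragingTwoLevel`) whose transcriptions the corollaries are about.  CITATION HEADER
(lean-in-tree rule 2026-08-18): NO sentence of Bałaban's series is newly quoted here; NO printed estimate, bound or convergence
statement is asserted; the analytic hypotheses of the restated theorems (`UniformGeomDefect`, `InjectedRate`,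
`LadderGoodBadRate` — NOT PRINTED for Bałaban's densities, see `T4ObservableTelescopeTwoRun` §6) stay hypotheses.

## Why

`T4ObservableTelescopeTwoRun` v3.1 reduced its relocation interface (Q-av) — "run `k+1+m`'s level-`(k+1)` fields read as run
`k+m`'s level-`k` fields, the two pulled-back loop products being one function" (`MidRelocation`) — to a RUN LADDER
`RunLadder D`: level maps `ι_{j,j+1}` between consecutive runs, measurable, intertwining the two runs' averagings (`step`) and
preserving unit-level loop variables (`loop`), and proved `hasContinuumLimit_of_ladder`; it records (Q-av) as OPEN for the cell's
data type because `FiniteEpsData` carries each run's averagings on its own lattice types with no identification between runs.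
`T4VarianceMatching` §6 asks for the same identification one level from the start of the runs (`NestedFactorisation.nest`:
`A_{K+1} = A_K ∘ B_K`).  `T4LevelShift` (same unit) supplies the canonical identification `ladderShift` / `unitShift` of the
cell's parameter family and proves `step` for Bałaban's block averagings; this file packages the result in the two consumers'
structures.  For a GENERAL datum the property `AvgLevelHomogeneous` remains a hypothesis (the data type allows level-dependent
prescriptions); for the block-averaged data of the apex lineage (`IsBlockAveraged(₂)`, `IsPrintedAveraged₁/₂`, which unfold to
the hypothesis `∀ K j, D.av K j = blockAvg ℰ` resp. `= blockAvg₂ 𝓜 ℰ` used below) it is a theorem.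

## What this file adds (and only this)

§1 `scaleLadder D hD K K' hK : ScaleLadder (F.P K) (F.P K') (D.av K) (D.av K')` and **`runLadder D hD : RunLadder D`** for
   `hD : D.AvgLevelHomogeneous` (`ι := ladderShift`, `step := hD`, `loop := loopAt_ladderShift`); its relocation map at
   `(Cs, k, m)` is `ladderShift` (`runLadder_midRelocation_ι`, `rfl`) and preserves the product Haar measures;
   `runLadderOfBlockAvg D ℰ h`, `runLadderOfBlockAvg₂ D 𝓜 ℰ h` for (0.4)- resp. (0.12)-averaged data.
§2 `CanonicalGoodBadRate D hD g₀ Λ E ρ inj := LadderGoodBadRate D (runLadder D hD) g₀ Λ E ρ inj` (hypothesis shape, NOT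
   PRINTED: the good/bad density datum of §6.3 upstream with the relocation FIXED by the kernel — no interface datum left),
   `⇒ MidGoodBadRate`, and existence `hasContinuumLimit_of_canonical` (= `hasContinuumLimit_of_ladder` along the canonical
   ladder), `hasContinuumLimit_of_blockAvg` / `…_of_blockAvg₂` (measurability from `avgMeasurable_of_blockAvg(₂)` too: for
   block-averaged data over a `RegularGaugeGroup` with measurable `ℰ`, `𝓜` the ONLY hypotheses left are the analytic ones).
§3 `unitFactorisation D hM g₀ : UnitFactorisation (D.scheme g₀) (GaugeField (F.P 0) 0 G)` (`A_K := unitShift K ∘ iter (D.av K) K`,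
   `W_C := loopAt · (C.atLevel 0)`, `K`-independent) and **`nestedFactorisation D hM hD g₀ : NestedFactorisation (D.scheme g₀) _`**
   (`B_K := ladderShift ∘ (D.av (K+1) 0).avg`, `nest := unitShift_iter_succ`), with `…OfBlockAvg`, `…OfBlockAvg₂`.

WHAT IS NOT PROVED / VALUE.  Nothing analytic: `UniformGeomDefect`, `LadderGoodBadRate` / `CanonicalGoodBadRate`, and every
rate of `T4VarianceMatching` stated over a `NestedFactorisation` remain hypotheses NOT PRINTED for Bałaban's densities (their
walls are recorded upstream).  VALUE = the interface halves of the two lanes are no longer supplier data for Bałaban's own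
averaging prescriptions: what a future supplier owes is analytic only.  NOT summit progress.

Upstream: `T4LevelShift`, `T4ObservableTelescopeTwoRun` (hence `T4ObservableTelescope`, `T4CauchySum`, `T4VarianceMatching`,
`T4Continuum`, `BlockAveragingTwoLevel`, …).  Consumers (by name, nothing of theirs edited): the (Q-av)/NE1′ supplier lineage
(t4-ne1p-p3), the NE7 lineage (`T4VarianceMatching` §6–§7, `T4ApexVariance`), the apex lineage (`T4ApexTelescope`).
-/

noncomputable section

namespace Literature.MathematicalPhysics.QuantumFieldTheory.Balaban1983to89.T4RunLadder

open MeasureTheory T4Continuum T4LevelShift T4ObservableTelescopeTwoRun Missing T4CauchySum T4VarianceMatching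

variable {F : T4Family} {G : Type*} [GaugeGroup G] [MeasurableSpace G] [HaarData G]

/-! ## §1 The canonical scale ladders and the canonical run ladder -/

/-- **THE CANONICAL SCALE LADDER between runs `K` and `K' = K + 1`** of a level-homogeneous datum: `ι := ladderShift`,
measurable, `step` = the hypothesis. [folklore] -/
def scaleLadder (D : FiniteEpsData F G) (hD : D.AvgLevelHomogeneous) (K K' : ℕ) (hK : K' = K + 1) :
    ScaleLadder (F.P K) (F.P K') (D.av K) (D.av K') where
  ι _ _ hj := ladderShift hK hj
  measurable_ι _ _ hj := measurable_ladderShift hK hj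
  step j j' hj h₁ V := hD K K' hK j j' hj h₁ V

/-- **THE CANONICAL RUN LADDER** of a level-homogeneous datum ((Q-av) of `T4ObservableTelescopeTwoRun` ANSWERED for such data):
the canonical scale ladders plus unit-level loop compatibility (`loopAt_ladderShift`, which holds for every datum). [folklore] -/
def runLadder (D : FiniteEpsData F G) (hD : D.AvgLevelHomogeneous) : RunLadder D where
  lad K K' hK := scaleLadder D hD K K' hK
  loop _ _ hK V C := loopAt_ladderShift hK V C.1

/-- The canonical ladder's maps are `ladderShift`. [folklore] -/
@[simp] theorem runLadder_ι (D : FiniteEpsData F G) (hD : D.AvgLevelHomogeneous) (K K' : ℕ) (hK : K' = K + 1) (j j' : ℕ)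
    (hj : j' = j + 1) : ((runLadder D hD).lad K K' hK).ι j j' hj = ladderShift hK hj :=
  rfl

/-- The canonical ladder's relocation map at `(Cs, k, m)` is `ladderShift : GaugeField (F.P (k+1+m)) (k+1) G → GaugeField (F.P (k+m)) k G`. [folklore] -/
theorem runLadder_midRelocation_ι (D : FiniteEpsData F G) (hD : D.AvgLevelHomogeneous) (Cs : List (ULoop F)) (k m : ℕ) :
    ((runLadder D hD).midRelocation Cs k m).ι =
      ladderShift (K := k + m) (K' := k + 1 + m) (by omega) (j := k) (j' := k + 1) rfl :=
  rfl

/-- The canonical relocation preserves the product Haar measures (so normalised level laws are transported to normalised level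
laws: a supplier's `IsNormLaw … (R.midRelocation Cs k m).ι μ'` is a statement about a measure-preserving reindexing). [folklore] -/
theorem measurePreserving_midRelocation_ι (D : FiniteEpsData F G) (hD : D.AvgLevelHomogeneous) (Cs : List (ULoop F)) (k m : ℕ) :
    MeasurePreserving ((runLadder D hD).midRelocation Cs k m).ι
      (fieldMeasure (F.P (k + 1 + m)) (k + 1) G) (fieldMeasure (F.P (k + m)) k G) :=
  measurePreserving_ladderShift (K := k + m) (K' := k + 1 + m) (by omega) (j := k) (j' := k + 1) rfl

/-- **THE CANONICAL RUN LADDER OF A (0.4)-BLOCK-AVERAGED DATUM**, every small-loop average `ℰ`. [cite: Balaban1987RG1, (0.4) p.253] -/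
def runLadderOfBlockAvg (D : FiniteEpsData F G) (ℰ : LoopAverage G) (h : ∀ K j, D.av K j = BlockAveraging.blockAvg ℰ) :
    RunLadder D :=
  runLadder D (D.avgLevelHomogeneous_of_blockAvg ℰ h)

/-- **THE CANONICAL RUN LADDER OF A (0.12)-BLOCK-AVERAGED DATUM**, every `𝓜`, `ℰ`. [cite: Balaban1987RG1, (0.12) p.254] -/
def runLadderOfBlockAvg₂ (D : FiniteEpsData F G) (𝓜 : GroupAverage G) (ℰ : LoopAverage G)
    (h : ∀ K j, D.av K j = BlockAveragingTwoLevel.blockAvg₂ 𝓜 ℰ) : RunLadder D :=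
  runLadder D (D.avgLevelHomogeneous_of_blockAvg₂ 𝓜 ℰ h)

/-! ## §2 Existence along the canonical ladder -/

/-- HYPOTHESIS SHAPE (NOT PRINTED, never asserted) — **THE GOOD/BAD DATUM ALONG THE CANONICAL LADDER** of a level-homogeneous datum:
`LadderGoodBadRate` of `T4ObservableTelescopeTwoRun` with the relocation FIXED to `ladderShift` — a statement about the data's
normalised level laws and ONE density per `(Cs, k, m)`, with no interface datum left to supply. [folklore] -/
def CanonicalGoodBadRate (D : FiniteEpsData F G) (hD : D.AvgLevelHomogeneous) (g₀ : ℕ → ℝ) (Λ E ρ : ℝ)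
    (inj : ℕ → ℕ → ℝ) : Prop :=
  LadderGoodBadRate D (runLadder D hD) g₀ Λ E ρ inj

/-- `CanonicalGoodBadRate ⇒ MidGoodBadRate` (`midGoodBadRate_of_ladder`). [folklore] -/
theorem midGoodBadRate_of_canonical (D : FiniteEpsData F G) (hD : D.AvgLevelHomogeneous) (g₀ : ℕ → ℝ) {Λ E ρ : ℝ}
    {inj : ℕ → ℕ → ℝ} (h : CanonicalGoodBadRate D hD g₀ Λ E ρ inj) : MidGoodBadRate D g₀ Λ E ρ inj :=
  midGoodBadRate_of_ladder D (runLadder D hD) g₀ h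

/-- **EXISTENCE FOR A LEVEL-HOMOGENEOUS DATUM from one-run sizes and the good/bad datum along the CANONICAL ladder**
(`hasContinuumLimit_of_ladder` with the ladder supplied by the kernel). [folklore] -/
theorem hasContinuumLimit_of_canonical [RegularGaugeGroup G] (D : FiniteEpsData F G) (hM : D.AvgMeasurable)
    (hD : D.AvgLevelHomogeneous) (g₀ : ℕ → ℝ) (hU : UniformGeomDefect D g₀) {C θ E ρ Λ : ℝ} {c : ℕ} {inj : ℕ → ℕ → ℝ}
    (hinj : InjectedRate C c θ inj) (hE : 0 ≤ E) (hθ : 0 ≤ θ) (hθ1 : θ < 1) (hρ : 0 ≤ ρ) (hρ1 : ρ < 1) (hΛ : 1 ≤ Λ)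
    (h : CanonicalGoodBadRate D hD g₀ Λ E ρ inj) : HasContinuumLimit (D.scheme g₀) :=
  hasContinuumLimit_of_ladder D hM (runLadder D hD) g₀ hU hinj hE hθ hθ1 hρ hρ1 hΛ h

/-- **EXISTENCE FOR A (0.4)-BLOCK-AVERAGED DATUM** over a `RegularGaugeGroup` with a measurable small-loop average: measurability AND
the ladder come from the kernel (`BlockAveraging.avgMeasurable_of_blockAvg`, `runLadderOfBlockAvg`); the hypotheses left are the
one-run sizes `UniformGeomDefect`, an injected rate, and the good/bad datum along the canonical ladder — all NOT PRINTED. [folklore] -/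
theorem hasContinuumLimit_of_blockAvg [RegularGaugeGroup G] (D : FiniteEpsData F G) (ℰ : LoopAverage G)
    (hE : ∀ n, Measurable (fun W : Fin (n+1) → G => ℰ.E W)) (hD : ∀ K j, D.av K j = BlockAveraging.blockAvg ℰ)
    (g₀ : ℕ → ℝ) (hU : UniformGeomDefect D g₀) {C θ E ρ Λ : ℝ} {c : ℕ} {inj : ℕ → ℕ → ℝ}
    (hinj : InjectedRate C c θ inj) (hE0 : 0 ≤ E) (hθ : 0 ≤ θ) (hθ1 : θ < 1) (hρ : 0 ≤ ρ) (hρ1 : ρ < 1) (hΛ : 1 ≤ Λ)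
    (h : CanonicalGoodBadRate D (D.avgLevelHomogeneous_of_blockAvg ℰ hD) g₀ Λ E ρ inj) : HasContinuumLimit (D.scheme g₀) :=
  hasContinuumLimit_of_canonical D (D.avgMeasurable_of_blockAvg ℰ hE hD) _ g₀ hU hinj hE0 hθ hθ1 hρ hρ1 hΛ h

/-- **EXISTENCE FOR A (0.12)-BLOCK-AVERAGED DATUM** (measurable `𝓜`, `ℰ`; `BlockAveragingTwoLevel.avgMeasurable_of_blockAvg₂`). [folklore] -/
theorem hasContinuumLimit_of_blockAvg₂ [RegularGaugeGroup G] (D : FiniteEpsData F G) (𝓜 : GroupAverage G) (ℰ : LoopAverage G)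
    (hMm : ∀ n, Measurable (fun W : Fin (n+1) → G => 𝓜.M W)) (hE : ∀ n, Measurable (fun W : Fin (n+1) → G => ℰ.E W))
    (hD : ∀ K j, D.av K j = BlockAveragingTwoLevel.blockAvg₂ 𝓜 ℰ)
    (g₀ : ℕ → ℝ) (hU : UniformGeomDefect D g₀) {C θ E ρ Λ : ℝ} {c : ℕ} {inj : ℕ → ℕ → ℝ}
    (hinj : InjectedRate C c θ inj) (hE0 : 0 ≤ E) (hθ : 0 ≤ θ) (hθ1 : θ < 1) (hρ : 0 ≤ ρ) (hρ1 : ρ < 1) (hΛ : 1 ≤ Λ)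
    (h : CanonicalGoodBadRate D (D.avgLevelHomogeneous_of_blockAvg₂ 𝓜 ℰ hD) g₀ Λ E ρ inj) : HasContinuumLimit (D.scheme g₀) :=
  hasContinuumLimit_of_canonical D (D.avgMeasurable_of_blockAvg₂ 𝓜 ℰ hMm hE hD) _ g₀ hU hinj hE0 hθ hθ1 hρ hρ1 hΛ h

/-! ## §3 The canonical nested factorisation of the data's scheme (the `nest` interface of `T4VarianceMatching` §6) -/

/-- **THE CANONICAL UNIT FACTORISATION** of the scheme of a datum with measurable averagings over a `RegularGaugeGroup`: the common
space `X` is the configuration space of the unit lattice `USite` (= level `0` of run `0`), `A_K = unitShift K ∘ avg_{K-1} ∘ ⋯ ∘ avg_0`,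
`W_C(u) = loopAt u (C.atLevel 0)` (`K`-INDEPENDENT by `loopAt_unitShift`), `|W| ≤ 1`. [folklore] -/
def unitFactorisation [RegularGaugeGroup G] (D : FiniteEpsData F G) (hM : D.AvgMeasurable) (g₀ : ℕ → ℝ) :
    UnitFactorisation (D.scheme g₀) (GaugeField (F.P 0) 0 G) where
  A K U := unitShift K (Averaging.iter (D.av K) K U)
  measurable_A K := (measurable_unitShift K).comp (measurable_iter (D.av K) (hM K) K)
  W C u := loopAt u (C.1.atLevel 0)
  measurable_W C := measurable_loopAt (C.1.atLevel 0)
  abs_W_le_one _ _ := abs_loopAt_le_one _ _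
  fac K C U := (loopAt_unitShift K (Averaging.iter (D.av K) K U) C.1).symm

/-- **THE CANONICAL NESTED FACTORISATION** of the scheme of a LEVEL-HOMOGENEOUS datum with measurable averagings:
`B_K = ladderShift ∘ (D.av (K+1) 0).avg` (run `K+1`'s first averaging read on run `K`'s finest lattice) and `nest` =
`unitShift_iter_succ`.  (The interface of `T4VarianceMatching.NestedFactorisation` INHABITED for such data — in particular for every
(0.4)/(0.12)-block-averaged datum over a `RegularGaugeGroup` with measurable averages; its `descLaw`, `FineTransportRate`,
`FineSecondMomentRate` thereby become statements about the data alone.) [folklore] -/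
def nestedFactorisation [RegularGaugeGroup G] (D : FiniteEpsData F G) (hM : D.AvgMeasurable) (hD : D.AvgLevelHomogeneous)
    (g₀ : ℕ → ℝ) : NestedFactorisation (D.scheme g₀) (GaugeField (F.P 0) 0 G) where
  toUnitFactorisation := unitFactorisation D hM g₀
  B K U := ladderShift rfl rfl ((D.av (K + 1) 0).avg U)
  measurable_B K := (measurable_ladderShift rfl rfl).comp (hM (K + 1) 0)
  nest _ U := D.unitShift_iter_succ hD rfl U

/-- [folklore] -/
@[simp] theorem nestedFactorisation_A [RegularGaugeGroup G] (D : FiniteEpsData F G) (hM : D.AvgMeasurable)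
    (hD : D.AvgLevelHomogeneous) (g₀ : ℕ → ℝ) (K : ℕ) (U : GaugeField (F.P K) 0 G) :
    (nestedFactorisation D hM hD g₀).A K U = unitShift K (Averaging.iter (D.av K) K U) :=
  rfl

/-- [folklore] -/
@[simp] theorem nestedFactorisation_B [RegularGaugeGroup G] (D : FiniteEpsData F G) (hM : D.AvgMeasurable)
    (hD : D.AvgLevelHomogeneous) (g₀ : ℕ → ℝ) (K : ℕ) (U : GaugeField (F.P (K + 1)) 0 G) :
    (nestedFactorisation D hM hD g₀).B K U = ladderShift rfl rfl ((D.av (K + 1) 0).avg U) :=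
  rfl

/-- [folklore] -/
@[simp] theorem nestedFactorisation_W [RegularGaugeGroup G] (D : FiniteEpsData F G) (hM : D.AvgMeasurable)
    (hD : D.AvgLevelHomogeneous) (g₀ : ℕ → ℝ) (C : ULoop F) (u : GaugeField (F.P 0) 0 G) :
    (nestedFactorisation D hM hD g₀).W C u = loopAt u (C.1.atLevel 0) :=
  rfl

/-- **THE CANONICAL NESTED FACTORISATION OF A (0.4)-BLOCK-AVERAGED DATUM** (measurable `ℰ`, `RegularGaugeGroup`). [cite: Balaban1987RG1, (0.4) p.253] -/
def nestedFactorisationOfBlockAvg [RegularGaugeGroup G] (D : FiniteEpsData F G) (ℰ : LoopAverage G)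
    (hE : ∀ n, Measurable (fun W : Fin (n+1) → G => ℰ.E W)) (hD : ∀ K j, D.av K j = BlockAveraging.blockAvg ℰ) (g₀ : ℕ → ℝ) :
    NestedFactorisation (D.scheme g₀) (GaugeField (F.P 0) 0 G) :=
  nestedFactorisation D (D.avgMeasurable_of_blockAvg ℰ hE hD) (D.avgLevelHomogeneous_of_blockAvg ℰ hD) g₀

/-- **THE CANONICAL NESTED FACTORISATION OF A (0.12)-BLOCK-AVERAGED DATUM** (measurable `𝓜`, `ℰ`). [cite: Balaban1987RG1, (0.12) p.254] -/
def nestedFactorisationOfBlockAvg₂ [RegularGaugeGroup G] (D : FiniteEpsData F G) (𝓜 : GroupAverage G) (ℰ : LoopAverage G)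
    (hMm : ∀ n, Measurable (fun W : Fin (n+1) → G => 𝓜.M W)) (hE : ∀ n, Measurable (fun W : Fin (n+1) → G => ℰ.E W))
    (hD : ∀ K j, D.av K j = BlockAveragingTwoLevel.blockAvg₂ 𝓜 ℰ) (g₀ : ℕ → ℝ) :
    NestedFactorisation (D.scheme g₀) (GaugeField (F.P 0) 0 G) :=
  nestedFactorisation D (D.avgMeasurable_of_blockAvg₂ 𝓜 ℰ hMm hE hD) (D.avgLevelHomogeneous_of_blockAvg₂ 𝓜 ℰ hD) g₀

end Literature.MathematicalPhysics.QuantumFieldTheory.Balaban1983to89.T4RunLadder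

end
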